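import Summits.HodgeConjecture.HodgeConjecture.Theses.NoetherLefschetzOneUp
import Summits.HodgeConjecture.HodgeConjecture.Theorems.NoetherLefschetzOneUpNetReduction
import HarnessLib

/-!
# Route NoetherLefschetzOneUp — crux `FourfoldsGrantedK3Nets` (stmt-HodgeConjecture-14599), line `birth`:
the NET TRICHOTOMY GLUE and the unconditional `NetReduction`

Helper file of the crux `FourfoldsGrantedK3Nets := K3TypeNets → HC(4,2)` (THE FOURFOLD MIDDLE DEGREE,
GRANTED THE K3-TYPE SECTOR), line `birth` (`Cruxes/FourfoldsGrantedK3Nets/Lines/birth.lean`).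

* `noetherLefschetzOneUp_netReduction` — the route's support item `NetReduction`
  (stmt-HodgeConjecture-11604) holds UNCONDITIONALLY: the landed reduction
  `netReduction_of_hasFibreHodgeNumber` (net existence `exists_fiberNet_smoothBase_nonempty_holds`,
  Hartshorne II 7.17.3 + III 10.7; birational descent of algebraicity) fed with the Literature theorem
  `Motives.fiberNet_exists_hasFibreHodgeNumber_holds` (Voisin I Cor. 9.19 / Prop. 9.20: the Hodge
  numbers of the smooth fibres of a net are constant), which landed after the item was parked.
* `noetherLefschetzOneUp_fourfoldsGrantedK3Nets_of_trichotomy` — the planners' foreseen support child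
  `NetTrichotomyGlue` (route header, TWO-LAYER PLAN), sorry-free: `LevelZeroNets` (g = 0), GENERAL-TYPE
  NETS (g ≥ 2, stated unfolded — the refuter-vetted text of the retired typed crux
  stmt-HodgeConjecture-11601) and `VerticalHodgeAlgebraic` imply the crux, the crux's own hypothesis
  `K3TypeNets` serving the `g = 1` branch and `NetReduction` being the theorem above.
* `noetherLefschetzOneUp_generalTypeNets_of_fourfoldsGrantedK3Nets` /
  `noetherLefschetzOneUp_generalTypeNets_iff_fourfoldsGrantedK3Nets` — the converse bookkeeping: granted
  `K3TypeNets`, the crux implies GENERAL-TYPE NETS outright (`Submodule.span_le`, `le_sup_left`), so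
  modulo the two print pieces `LevelZeroNets` and `VerticalHodgeAlgebraic` and the crux hypothesis the
  stub `stub_generalTypeNets` of line `birth` is EQUIVALENT to the crux (it is crux-sized, as the card says).

## References

* D. Arapura, *Hodge cycles and the Leray filtration*, Pacific J. Math. 319 (2022), Cor. 1.4–1.5. [Arapura2022]
* C. Voisin, *Hodge Theory and Complex Algebraic Geometry I* (2002), §9.3.1 Cor. 9.19, §9.3.2 Prop. 9.20. [VoisinHodgeI2002]
* R. Hartshorne, *Algebraic Geometry* (1977), II Example 7.17.3, III Cor. 10.7. [Hartshorne1977]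
* P. Deligne, *The Hodge conjecture*, Clay Mathematics Institute (2000), §1. [Deligne2000]
-/

set_option linter.dupNamespace false

noncomputable section

namespace Summit.HodgeConjecture.HodgeConjecture.Theorems

open CategoryTheory AlgebraicGeometry
open Literature.AlgebraicGeometry Literature.AlgebraicGeometry.Motives
open Literature.AlgebraicGeometry.HodgeTheory
open Summit.HodgeConjecture.HodgeConjecture.Theses.NoetherLefschetzOneUp

/-- **`NetReduction` (support item stmt-HodgeConjecture-11604) holds unconditionally**: every smooth
projective complex fourfold `X` enters through a net — a smooth projective fourfold `X'` (the total
space of a surface net on `X`) with a surjective `f : X' ⟶ ℙ²` whose fibres over the complex points off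
a proper Zariski-closed `T` are smooth projective surfaces admitting Hodge models with ONE constant
`h^{2,0} = g`, algebraicity of rational `(2,2)`-classes descending from `X'` to `X`. Proof: the landed
reduction `netReduction_of_hasFibreHodgeNumber` fed with the Literature theorem
`Motives.fiberNet_exists_hasFibreHodgeNumber_holds` (constancy of the fibre Hodge numbers of a net,
Voisin I Cor. 9.19 / Prop. 9.20). [cite: VoisinHodgeI2002, §9.3.1 Cor. 9.19 and §9.3.2 Prop. 9.20]
[cite: Hartshorne1977, II Example 7.17.3 and III Cor. 10.7] -/
theorem noetherLefschetzOneUp_netReduction :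
    Summit.HodgeConjecture.HodgeConjecture.Theses.NoetherLefschetzOneUp.NetReduction :=
  netReduction_of_hasFibreHodgeNumber fiberNet_exists_hasFibreHodgeNumber_holds

/-- **NET TRICHOTOMY GLUE** (the route's foreseen support child `NetTrichotomyGlue` of the crux
`FourfoldsGrantedK3Nets`, stmt-HodgeConjecture-14599; sorry-free). If
(g = 0) `LevelZeroNets`, (g ≥ 2) GENERAL-TYPE NETS — for every net `f : X ⟶ ℙ²` on a smooth projective
fourfold whose fibres off a proper closed `T` are smooth projective surfaces with `h^{2,0} ≥ 2`,
`span{rational (2,2)} ≤ algebraicClasses X 2 ⊔ span{vertical rational (2,2)}` (stated unfolded: the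
refuter-vetted text of the retired typed crux stmt-HodgeConjecture-11601) — and `VerticalHodgeAlgebraic`
hold, then the crux holds: given `K3TypeNets` and a smooth projective fourfold `X`, `NetReduction`
(`noetherLefschetzOneUp_netReduction`) yields a netted fourfold `X' → ℙ²` of constant generic geometric
genus `g` with the transfer `HC(4,2)(X') ⇒ HC(4,2)(X)`; on `X'`, by `Nat.lt_trichotomy g 1`, the span
of the rational `(2,2)`-classes lies in `algebraic ⊔ vertical` by `hZ` (`g = 0`), by `K3TypeNets`
(`g = 1`) or by `hG` (`g ≥ 2`), and `hV` absorbs the vertical summand.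
[cite: Arapura2022, Cor. 1.4–1.5] [cite: Deligne2000, §1] -/
theorem noetherLefschetzOneUp_fourfoldsGrantedK3Nets_of_trichotomy
    (hZ : Summit.HodgeConjecture.HodgeConjecture.Theses.NoetherLefschetzOneUp.LevelZeroNets)
    (hG : ∀ ⦃X : SchemeOver ℂ⦄ (f : X ⟶ projectiveSpace 2 ℂ), IsSmoothProjective 4 X →
      Function.Surjective f.left.base →
      (∃ T : Set (projectiveSpace 2 ℂ).left, IsClosed T ∧ T ≠ Set.univ ∧
        ∀ s : AlgPoints (projectiveSpace 2 ℂ) ℂ, s.pt ∉ T →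
          IsSmoothProjective 2 (fiberOver f s) ∧
            ∃ A : HodgeModel 2 (fiberOver f s), 2 ≤ Module.finrank ℂ ↥(A.hodgePQ 2 2 0)) →
      Submodule.span ℂ {c : complexBetti X (2 * 2) |
          IsRationalClass c ∧ IsOfHodgeType 4 X (2 * 2) 2 2 c} ≤
        algebraicClasses X 2 ⊔ Submodule.span ℂ {c : complexBetti X (2 * 2) |
          IsRationalClass c ∧ IsOfHodgeType 4 X (2 * 2) 2 2 c ∧
            ∃ T : Set (projectiveSpace 2 ℂ).left, IsClosed T ∧ T ≠ Set.univ ∧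
              complexBetti.restrictCompl X (f.left.base ⁻¹' T) (2 * 2) c = 0})
    (hV : Summit.HodgeConjecture.HodgeConjecture.Theses.NoetherLefschetzOneUp.VerticalHodgeAlgebraic) :
    Summit.HodgeConjecture.HodgeConjecture.Theses.NoetherLefschetzOneUp.FourfoldsGrantedK3Nets := by
  unfold Summit.HodgeConjecture.HodgeConjecture.Theses.NoetherLefschetzOneUp.FourfoldsGrantedK3Nets
  intro hK3 X hX
  -- every fourfold enters through a net of constant generic geometric genus `g`
  obtain ⟨X', f, hX', hf, ⟨T, hT, hTne, g, hfib⟩, htransfer⟩ := noetherLefschetzOneUp_netReduction hX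
  refine htransfer ?_
  intro c' hc' hpp'
  -- the trichotomy on `g`: rational (2,2)-classes of `X'` are algebraic ⊔ vertical
  have hspan :
      Submodule.span ℂ {c : complexBetti X' (2 * 2) | IsRationalClass c ∧ IsOfHodgeType 4 X' (2 * 2) 2 2 c} ≤
        algebraicClasses X' 2 ⊔ Submodule.span ℂ {c : complexBetti X' (2 * 2) | IsRationalClass c ∧
          IsOfHodgeType 4 X' (2 * 2) 2 2 c ∧ ∃ T : Set (projectiveSpace 2 ℂ).left, IsClosed T ∧
            T ≠ Set.univ ∧ complexBetti.restrictCompl X' (f.left.base ⁻¹' T) (2 * 2) c = 0} := by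
    rcases Nat.lt_trichotomy g 1 with hg | rfl | hg
    · -- `g = 0`: Arapura's level zero
      obtain rfl : g = 0 := Nat.lt_one_iff.mp hg
      exact hZ f hX' hf ⟨T, hT, hTne, hfib⟩
    · -- `g = 1`: the K3-type sector, i.e. the crux's hypothesis
      exact hK3 f hX' hf ⟨T, hT, hTne, hfib⟩
    · -- `g ≥ 2`: general-type nets
      refine hG f hX' hf ⟨T, hT, hTne, fun s hs => ?_⟩
      obtain ⟨h2, A, hA⟩ := hfib s hs
      exact ⟨h2, A, by omega⟩
  have hmem := hspan (Submodule.subset_span ⟨hc', hpp'⟩)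
  -- vertical classes are algebraic
  exact (sup_le le_rfl (hV f hX' hf)) hmem

/-- **The crux implies GENERAL-TYPE NETS, granted `K3TypeNets`** (bookkeeping for the hardness of the
stub `stub_generalTypeNets` of line `birth`): under `K3TypeNets` the crux gives HC(4,2), and HC(4,2)
puts every rational `(2,2)`-class in `algebraicClasses X 2 ≤ algebraic ⊔ vertical` — the net hypotheses
are not used. [cite: Deligne2000, §1] -/
theorem noetherLefschetzOneUp_generalTypeNets_of_fourfoldsGrantedK3Nets
    (hK3 : Summit.HodgeConjecture.HodgeConjecture.Theses.NoetherLefschetzOneUp.K3TypeNets)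
    (h : Summit.HodgeConjecture.HodgeConjecture.Theses.NoetherLefschetzOneUp.FourfoldsGrantedK3Nets) :
    ∀ ⦃X : SchemeOver ℂ⦄ (f : X ⟶ projectiveSpace 2 ℂ), IsSmoothProjective 4 X →
      Function.Surjective f.left.base →
      (∃ T : Set (projectiveSpace 2 ℂ).left, IsClosed T ∧ T ≠ Set.univ ∧
        ∀ s : AlgPoints (projectiveSpace 2 ℂ) ℂ, s.pt ∉ T →
          IsSmoothProjective 2 (fiberOver f s) ∧
            ∃ A : HodgeModel 2 (fiberOver f s), 2 ≤ Module.finrank ℂ ↥(A.hodgePQ 2 2 0)) →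
      Submodule.span ℂ {c : complexBetti X (2 * 2) |
          IsRationalClass c ∧ IsOfHodgeType 4 X (2 * 2) 2 2 c} ≤
        algebraicClasses X 2 ⊔ Submodule.span ℂ {c : complexBetti X (2 * 2) |
          IsRationalClass c ∧ IsOfHodgeType 4 X (2 * 2) 2 2 c ∧
            ∃ T : Set (projectiveSpace 2 ℂ).left, IsClosed T ∧ T ≠ Set.univ ∧
              complexBetti.restrictCompl X (f.left.base ⁻¹' T) (2 * 2) c = 0} := by
  intro X f hX _ _
  exact le_sup_of_le_left (Submodule.span_le.mpr fun c hc ↦ h hK3 hX c hc.1 hc.2)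

/-- **The stub `stub_generalTypeNets` is crux-sized**: granted the crux's own hypothesis `K3TypeNets`
and the two print pieces `LevelZeroNets` and `VerticalHodgeAlgebraic` of the trichotomy, GENERAL-TYPE
NETS is EQUIVALENT to the crux `FourfoldsGrantedK3Nets` (`→`: the glue
`noetherLefschetzOneUp_fourfoldsGrantedK3Nets_of_trichotomy`; `←`:
`noetherLefschetzOneUp_generalTypeNets_of_fourfoldsGrantedK3Nets`). [cite: Deligne2000, §1]
[cite: Arapura2022, Cor. 1.4–1.5] -/
theorem noetherLefschetzOneUp_generalTypeNets_iff_fourfoldsGrantedK3Nets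
    (hK3 : Summit.HodgeConjecture.HodgeConjecture.Theses.NoetherLefschetzOneUp.K3TypeNets)
    (hZ : Summit.HodgeConjecture.HodgeConjecture.Theses.NoetherLefschetzOneUp.LevelZeroNets)
    (hV : Summit.HodgeConjecture.HodgeConjecture.Theses.NoetherLefschetzOneUp.VerticalHodgeAlgebraic) :
    (∀ ⦃X : SchemeOver ℂ⦄ (f : X ⟶ projectiveSpace 2 ℂ), IsSmoothProjective 4 X →
      Function.Surjective f.left.base →
      (∃ T : Set (projectiveSpace 2 ℂ).left, IsClosed T ∧ T ≠ Set.univ ∧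
        ∀ s : AlgPoints (projectiveSpace 2 ℂ) ℂ, s.pt ∉ T →
          IsSmoothProjective 2 (fiberOver f s) ∧
            ∃ A : HodgeModel 2 (fiberOver f s), 2 ≤ Module.finrank ℂ ↥(A.hodgePQ 2 2 0)) →
      Submodule.span ℂ {c : complexBetti X (2 * 2) |
          IsRationalClass c ∧ IsOfHodgeType 4 X (2 * 2) 2 2 c} ≤
        algebraicClasses X 2 ⊔ Submodule.span ℂ {c : complexBetti X (2 * 2) |
          IsRationalClass c ∧ IsOfHodgeType 4 X (2 * 2) 2 2 c ∧
            ∃ T : Set (projectiveSpace 2 ℂ).left, IsClosed T ∧ T ≠ Set.univ ∧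
              complexBetti.restrictCompl X (f.left.base ⁻¹' T) (2 * 2) c = 0}) ↔
    Summit.HodgeConjecture.HodgeConjecture.Theses.NoetherLefschetzOneUp.FourfoldsGrantedK3Nets :=
  ⟨fun hG ↦ noetherLefschetzOneUp_fourfoldsGrantedK3Nets_of_trichotomy hZ hG hV,
    fun h ↦ noetherLefschetzOneUp_generalTypeNets_of_fourfoldsGrantedK3Nets hK3 h⟩

end Summit.HodgeConjecture.HodgeConjecture.Theorems

end
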